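import Summits.BirchSwinnertonDyer.BirchSwinnertonDyer.Theorems.SylvesterTwoHeegnerIndexThmCThreeTorsion
import Literature.NumberTheory.EllipticCurves.HuShuYin2019.SylvesterThreePart
import HarnessLib

/-!
# Route `SylvesterTwoHeegnerIndex` (rung K7t), THEOREM C step (C-d)₃, part 2 — the CM bookkeeping
# `T ↦ T − [ω]T : E₁[3] ↠ E₁[√−3] = {𝒪, (0, ±12√−3)}` made KERNEL

HONEST FRAMING (cell b2b-bsdres, seat x1b GEN 50 = O12 class lead; `--supports
stmt-BirchSwinnertonDyer-19802 --as helper` = the cell's THEOREM C item `HSYPointTwoDivisibleSevenModNine`, crux r201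
of route K7t after the gen-10 cascade; part 1 landed as p473118). Sequel of `…ThmCThreeTorsion.lean` (§0–§3: `E₁[3]` is
exactly the nine points `𝒪, (0, ±12√−3), (12ζ, ±36)`). MEMO-bsd-cm-two v2.8 §15.5 (C-d) / §40.1 (C-d)₃
uses: «since `T ↦ T − [ω]T` maps `E₁[3]` onto `E₁[√−3] = ⟨(0, 12√−3)⟩` there is `T′ ∈ E₁[3](K)` with
… » — recorded as «CELL (finite check; not kernel)». HERE IT IS KERNEL, for every Mordell equation with
`a₆ = −432` over any field `F` (`2, 3 ≠ 0`, `ω² + ω + 1 = 0`, `√−3 := 2ω + 1`) and EVERY self-map `θ` of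
the point group acting by Hu–Shu–Yin's printed complex multiplication `[ω](x, y) = (ωx, y)`
([HuShuYin2019] p. 4; hypotheses `hθ`, `hθ0 : θ 𝒪 = 𝒪`; such a `θ` exists and is additive:
`SylvesterTwoCMNormForm.exists_omegaRot`):

* §4 **the chord computation** `some_add_neg_omega_of_cube`: for `T = (x, y)`, `x³ = 1728`, the line
  through `T` and `−[ω]T = (ωx, −y)` has slope `L`, `L·(1−ω)x = 2y`, `L² = −ω²x`, so it meets `E₁` again
  above `x₃ = L² − x − ωx = 0` and `T − [ω]T = (0, y′)` with `3y′ = (2ω+1)·y` (`y′ = y·√−3/3`);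
  corollaries `sub_omegaRot_thirtySix` / `sub_omegaRot_neg_thirtySix` (`(12ζ, ±36) ↦ (0, ±12√−3)`) and
  `sub_omegaRot_of_X_eq_zero` (`[ω]` fixes the points above `x = 0`);
* §5 **the exact sequence on `E₁[3]`**: `sub_omegaRot_mem_sqrtNegThreeTorsion` (IMAGE ⊂ `E₁[√−3]`),
  `exists_threeTorsion_sub_omegaRot_eq` (ONTO: witnesses `𝒪`, `(12, 36)`, `(12, −36)`),
  `sub_omegaRot_eq_zero_iff` (KERNEL = `E₁[√−3]`, i.e. `1 − [ω] ≠ 0` off `E₁[√−3]`).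

DEF-FREE; NO named fact, NO sorry, axioms standard. WHAT THIS IS NOT: not THEOREM C ((C-a), (C-b)₁,
(C-b)₂, (C-d)₂ stay PRINT/CELL, memo §40.2); nothing about `Ш`; closes no item; nothing booked; no label
moves. References: MEMO-bsd-cm-two v2.8 §15.5 (C-d), §40.1; [HuShuYin2019] pp. 4, 7–8;
[SilvermanAEC2009] III.2.3.
-/

set_option autoImplicit false
-- the Summit-side namespace `Summit.BirchSwinnertonDyer.BirchSwinnertonDyer.…` (summit = problem) is mandated by D-0017
set_option linter.dupNamespace false

noncomputable section

open scoped Classical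

open WeierstrassCurve WeierstrassCurve.Affine WeierstrassCurve.Affine.Point

namespace Summit.BirchSwinnertonDyer.BirchSwinnertonDyer.Theorems.SylvesterTwoThmCTorsion

open SylvesterTwoCMNormForm

variable {F : Type*} [Field F] {W : WeierstrassCurve F} {ω : F}


/-! ## §4 `T − [ω]T` for the nine points -/

section OneSubOmega

variable (hω : ω ^ 2 + ω + 1 = 0) (h2F : (2 : F) ≠ 0) (h3F : (3 : F) ≠ 0) (h1 : W.a₁ = 0)
  (h2 : W.a₂ = 0) (h3 : W.a₃ = 0) (h4 : W.a₄ = 0) (h6 : W.a₆ = -432)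

include hω h2F h3F h1 h2 h3 h4 h6

omit hω h1 h2 h3 h4 h6 in
/-- `x ≠ 0` when `x³ = 1728` (`1728 = 2⁶·3³ ≠ 0`). [folklore] -/
theorem X_ne_zero_of_cube {x : F} (hx : x ^ 3 = 1728) : x ≠ 0 := by
  rintro rfl
  have h' : (2 : F) ^ 6 * 3 ^ 3 = 0 := by linear_combination -hx
  exact absurd h' (mul_ne_zero (pow_ne_zero _ h2F) (pow_ne_zero _ h3F))

/-- The image ordinate: if `(x, y) ∈ E₁(F)` with `x³ = 1728` and `3y' = (2ω+1)·y` then `(0, y') ∈ E₁(F)`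
(`9y'² = −3y² = −3·1296`, i.e. `y'² = −432`). [folklore] -/
theorem nonsingular_zero_of_three_mul_eq {x y y' : F} (hp : W.toAffine.Nonsingular x y)
    (hx : x ^ 3 = 1728) (hy' : 3 * y' = (2 * ω + 1) * y) : W.toAffine.Nonsingular 0 y' := by
  have heq := (equation_iff_mordell h1 h2 h3 h4 h6 x y).mp hp.left
  have hy0 := Y_ne_zero_of_cube h2F h3F h1 h2 h3 h4 h6 hp hx
  have h9 : (9 : F) ≠ 0 := by
    intro h
    apply h3F
    have : (3 : F) * 3 = 0 := by linear_combination h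
    simpa using this
  refine nonsingular_of_Y_ne_zero h2F h1 h2 h3 h4 h6 ?_ ?_
  · have e : (3 * y') ^ 2 = ((2 * ω + 1) * y) ^ 2 := by rw [hy']
    have key : (9 : F) * (y' ^ 2 - (0 ^ 3 - 432)) = 0 := by
      linear_combination e + 4 * y ^ 2 * hω - 3 * heq - 3 * hx
    exact sub_eq_zero.mp ((mul_eq_zero.mp key).resolve_left h9)
  · intro h
    rw [h, mul_zero] at hy'
    exact mul_ne_zero (two_omega_add_one_ne_zero hω h3F) hy0 hy'.symm

/-- **THE CHORD COMPUTATION.** For `T = (x, y) ∈ E₁(F)` with `x³ = 1728` (so `y = ±36`), the line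
through `T` and `−[ω]T = (ωx, −y)` has slope `L = 2y/((1−ω)x)` with `L² = 4y²/(−3ω·x²) = −ω²x`, hence
meets `E₁` a third time above `x₃ = L² − x − ωx = −x(1 + ω + ω²) = 0`, and
`T − [ω]T = (0, Lx − y) = (0, y') ` with `3y' = (2ω+1)y` (i.e. `y' = y·√−3/3`:
`(12ζ, ±36) ↦ (0, ±12√−3)`). [cite: SilvermanAEC2009, III.2.3] -/
theorem some_add_neg_omega_of_cube {x y y' : F} (hp : W.toAffine.Nonsingular x y) (hx : x ^ 3 = 1728)
    (hy' : 3 * y' = (2 * ω + 1) * y) :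
    (.some x y hp : W.toAffine.Point) + -.some (ω * x) y (nonsingular_omega_mul hω h1 h2 h3 h4 hp) =
      .some 0 y' (nonsingular_zero_of_three_mul_eq hω h2F h3F h1 h2 h3 h4 h6 hp hx hy') := by
  have heq := (equation_iff_mordell h1 h2 h3 h4 h6 x y).mp hp.left
  have hx0 : x ≠ 0 := X_ne_zero_of_cube h2F h3F hx
  have hden0 : (1 - ω) * x ≠ 0 := mul_ne_zero (one_sub_omega_ne_zero hω h3F) hx0
  have hden' : x - ω * x ≠ 0 := by
    intro h
    apply hden0
    linear_combination h
  have hne : x ≠ ω * x := fun h => hden' (sub_eq_zero.mpr h)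
  rw [Affine.Point.neg_some, Affine.Point.add_of_X_ne' hne, Affine.Point.neg_some]
  have hneg : W.toAffine.negY (ω * x) y = -y := by
    simp only [Affine.negY, h1, h3, zero_mul, sub_zero]
  simp only [hneg]
  set L := W.toAffine.slope x (ω * x) y (-y) with hLdef
  have hL : L * ((1 - ω) * x) = 2 * y := by
    rw [hLdef, Affine.slope_of_X_ne hne, div_mul_eq_mul_div, div_eq_iff hden']
    ring
  have hL2 : L ^ 2 = -ω ^ 2 * x := by
    have hc : ((1 - ω) * x) ^ 2 ≠ 0 := pow_ne_zero 2 hden0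
    apply mul_right_cancel₀ hc
    have e : (L * ((1 - ω) * x)) ^ 2 = (2 * y) ^ 2 := by rw [hL]
    linear_combination e + 4 * heq + (4 + ω ^ 2 - 2 * ω ^ 3 + ω ^ 4) * hx +
      1728 * (ω ^ 2 - 3 * ω + 3) * hω
  have hX : W.toAffine.addX x (ω * x) L = 0 := by
    simp only [Affine.addX, h1, h2, zero_mul, add_zero, sub_zero]
    linear_combination hL2 - x * hω
  simp only [Affine.Point.some.injEq]
  refine ⟨hX, ?_⟩
  rw [Affine.negAddY, hX]
  simp only [Affine.negY, h1, h3, zero_mul, sub_zero, zero_sub, mul_neg]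
  have h3ω : (3 : F) * (1 - ω) ≠ 0 := mul_ne_zero h3F (one_sub_omega_ne_zero hω h3F)
  apply mul_right_cancel₀ h3ω
  linear_combination 3 * hL - (1 - ω) * hy' + 2 * y * hω

variable {θ : W.toAffine.Point → W.toAffine.Point}
  (hθ : ∀ (x y : F) (h : W.toAffine.Nonsingular x y),
    θ (.some x y h) = .some (ω * x) y (nonsingular_omega_mul hω h1 h2 h3 h4 h))

include hθ

/-- **`T − [ω]T = (0, y·√−3/3)` for `T = (x, y)`, `x³ = 1728`** (any `θ` acting by `[ω](x,y) = (ωx, y)`).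
[cite: HuShuYin2019, p. 8] -/
theorem sub_omegaRot_of_cube {x y y' : F} (hp : W.toAffine.Nonsingular x y) (hx : x ^ 3 = 1728)
    (hy' : 3 * y' = (2 * ω + 1) * y) :
    (.some x y hp : W.toAffine.Point) - θ (.some x y hp) =
      .some 0 y' (nonsingular_zero_of_three_mul_eq hω h2F h3F h1 h2 h3 h4 h6 hp hx hy') := by
  rw [sub_eq_add_neg, hθ]
  exact some_add_neg_omega_of_cube hω h2F h3F h1 h2 h3 h4 h6 hp hx hy'

/-- **`(x, 36) − [ω](x, 36) = (0, 12√−3)`** for `x ∈ {12, 12ω, 12ω²}`. [cite: HuShuYin2019, p. 8] -/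
theorem sub_omegaRot_thirtySix {x : F} (hx : x ^ 3 = 1728) :
    (.some x 36 (nonsingular_cubeRoot_thirtySix h2F h1 h2 h3 h4 h6 h3F hx) : W.toAffine.Point) -
        θ (.some x 36 (nonsingular_cubeRoot_thirtySix h2F h1 h2 h3 h4 h6 h3F hx)) =
      .some 0 (12 * (2 * ω + 1)) (nonsingular_zero_twelveSqrt h2F h1 h2 h3 h4 h6 hω h3F) :=
  sub_omegaRot_of_cube hω h2F h3F h1 h2 h3 h4 h6 hθ _ hx (by ring)

/-- **`(x, −36) − [ω](x, −36) = (0, −12√−3)`** for `x ∈ {12, 12ω, 12ω²}` — in particular for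
Hu–Shu–Yin's `T = (12ω^{i+2}, −36)`. [cite: HuShuYin2019, p. 8] -/
theorem sub_omegaRot_neg_thirtySix {x : F} (hx : x ^ 3 = 1728) :
    (.some x (-36) (nonsingular_cubeRoot_neg_thirtySix h2F h1 h2 h3 h4 h6 h3F hx) : W.toAffine.Point) -
        θ (.some x (-36) (nonsingular_cubeRoot_neg_thirtySix h2F h1 h2 h3 h4 h6 h3F hx)) =
      .some 0 (-(12 * (2 * ω + 1))) (nonsingular_zero_neg_twelveSqrt h2F h1 h2 h3 h4 h6 hω h3F) :=
  sub_omegaRot_of_cube hω h2F h3F h1 h2 h3 h4 h6 hθ _ hx (by ring)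

omit h2F h3F h6 in
/-- **`T − [ω]T = 𝒪` for `T = (0, y)`** (`[ω]` fixes the points above `x = 0`: `ω·0 = 0`).
[cite: HuShuYin2019, p. 7] -/
theorem sub_omegaRot_of_X_eq_zero {y : F} (hp : W.toAffine.Nonsingular 0 y) :
    (.some 0 y hp : W.toAffine.Point) - θ (.some 0 y hp) = 0 := by
  have e : θ (.some 0 y hp) = .some 0 y hp := by simp only [hθ, mul_zero]
  rw [e, sub_self]

/-! ## §5 `1 − [ω]` maps `E₁[3]` ONTO `E₁[√−3] = {𝒪, (0, ±12√−3)}`, with kernel `E₁[√−3]` -/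

variable (hθ0 : θ 0 = 0)
include hθ0

/-- **IMAGE.** For every `T ∈ E₁[3](F)`: `T − [ω]T ∈ {𝒪, (0, 12√−3), (0, −12√−3)} = E₁[√−3]`.
[cite: HuShuYin2019, pp. 7–8] -/
theorem sub_omegaRot_mem_sqrtNegThreeTorsion (T : W.toAffine.Point) (hT : (3 : ℕ) • T = 0) :
    T - θ T = 0 ∨
      T - θ T = .some 0 (12 * (2 * ω + 1)) (nonsingular_zero_twelveSqrt h2F h1 h2 h3 h4 h6 hω h3F) ∨
      T - θ T = .some 0 (-(12 * (2 * ω + 1))) (nonsingular_zero_neg_twelveSqrt h2F h1 h2 h3 h4 h6 hω h3F) := by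
  rcases T with _ | ⟨x, y, hp⟩
  · left
    show (0 : W.toAffine.Point) - θ 0 = 0
    rw [hθ0, sub_self]
  · rcases (three_nsmul_eq_zero_iff h2F h3F h1 h2 h3 h4 h6 hp).mp hT with hx | hx
    · left
      subst hx
      exact sub_omegaRot_of_X_eq_zero hω h1 h2 h3 h4 hθ hp
    · right
      rcases Y_of_cube h1 h2 h3 h4 h6 hp.left hx with hy | hy
      · left
        subst hy
        exact sub_omegaRot_thirtySix hω h2F h3F h1 h2 h3 h4 h6 hθ hx
      · right
        subst hy
        exact sub_omegaRot_neg_thirtySix hω h2F h3F h1 h2 h3 h4 h6 hθ hx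

/-- **ONTO.** Every element of `E₁[√−3] = {𝒪, (0, ±12√−3)}` is `T − [ω]T` for some `T ∈ E₁[3](F)`
(witnesses `𝒪`, `(12, 36)`, `(12, −36)`) — the memo's «`T ↦ T − [ω]T` maps `E₁[3]` ONTO `E₁[√−3]`»,
i.e. for every `t′ ∈ ⟨(0, 12√−3)⟩` there is `T′ ∈ E₁[3](K)` with `T′ − [ω]T′ = t′`.
[cite: HuShuYin2019, p. 8] -/
theorem exists_threeTorsion_sub_omegaRot_eq (t : W.toAffine.Point)
    (ht : t = 0 ∨
      t = .some 0 (12 * (2 * ω + 1)) (nonsingular_zero_twelveSqrt h2F h1 h2 h3 h4 h6 hω h3F) ∨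
      t = .some 0 (-(12 * (2 * ω + 1))) (nonsingular_zero_neg_twelveSqrt h2F h1 h2 h3 h4 h6 hω h3F)) :
    ∃ T : W.toAffine.Point, (3 : ℕ) • T = 0 ∧ T - θ T = t := by
  rcases ht with rfl | rfl | rfl
  · exact ⟨0, smul_zero _, by rw [hθ0, sub_self]⟩
  · exact ⟨.some 12 36 (nonsingular_cubeRoot_thirtySix h2F h1 h2 h3 h4 h6 h3F twelve_pow_three),
      three_nsmul_eq_zero_of_cube h2F h3F h1 h2 h3 h4 h6 _ twelve_pow_three,
      sub_omegaRot_thirtySix hω h2F h3F h1 h2 h3 h4 h6 hθ twelve_pow_three⟩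
  · exact ⟨.some 12 (-36) (nonsingular_cubeRoot_neg_thirtySix h2F h1 h2 h3 h4 h6 h3F twelve_pow_three),
      three_nsmul_eq_zero_of_cube h2F h3F h1 h2 h3 h4 h6 _ twelve_pow_three,
      sub_omegaRot_neg_thirtySix hω h2F h3F h1 h2 h3 h4 h6 hθ twelve_pow_three⟩

omit hθ0 in
/-- **KERNEL.** On `E₁[3] ∖ 𝒪`, `T − [ω]T = 𝒪` iff `x(T) = 0`, i.e. iff `T ∈ E₁[√−3]` — «`1 − [ω] ≠ 0`
on `E₁[3] ∖ E₁[√−3]`». [cite: HuShuYin2019, pp. 7–8] -/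
theorem sub_omegaRot_eq_zero_iff {x y : F} (hp : W.toAffine.Nonsingular x y)
    (hT : (3 : ℕ) • (.some x y hp : W.toAffine.Point) = 0) :
    (.some x y hp : W.toAffine.Point) - θ (.some x y hp) = 0 ↔ x = 0 := by
  constructor
  · intro h0
    by_contra hx0
    have hx := ((three_nsmul_eq_zero_iff h2F h3F h1 h2 h3 h4 h6 hp).mp hT).resolve_left hx0
    rcases Y_of_cube h1 h2 h3 h4 h6 hp.left hx with hy | hy
    · subst hy
      rw [sub_omegaRot_thirtySix hω h2F h3F h1 h2 h3 h4 h6 hθ hx] at h0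
      exact Affine.Point.some_ne_zero _ h0
    · subst hy
      rw [sub_omegaRot_neg_thirtySix hω h2F h3F h1 h2 h3 h4 h6 hθ hx] at h0
      exact Affine.Point.some_ne_zero _ h0
  · rintro rfl
    exact sub_omegaRot_of_X_eq_zero hω h1 h2 h3 h4 hθ hp

end OneSubOmega

/-! ## §6 APPEND ⟦x1b GEN 50⟧ — the Hu–Shu–Yin curve `E₁ = cubeSumCurve 1` over a number field `K ∋ ω`

The statements of §1–§5 read off for the curve the memo actually means: `E₁ : y² = x³ − 432`, the
Weierstrass model `cubeSumCurve 1` of `x³ + y³ = 1` ([HuShuYin2019] p. 4), base-changed to any number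
field `K` containing `ω` (char `0`, so `2, 3 ≠ 0`), with `[ω]` ANY additive self-map acting by
`(x, y) ↦ (ωx, y)` (one exists: `SylvesterTwoCMNormForm.exists_omegaRot`). Nothing new is proved. -/

section HSY

open Literature.NumberTheory.EllipticCurves.HuShuYin2019 (cubeSumCurve)

variable {K : Type*} [Field K] [NumberField K] {ω : K}

/-- `E₁/K` has `a₁ = 0`. [cite: HuShuYin2019, p. 4] -/
theorem cubeSumCurve_one_a₁ : ((cubeSumCurve 1).baseChange K).a₁ = 0 := by
  simp [WeierstrassCurve.baseChange, cubeSumCurve]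

/-- `E₁/K` has `a₂ = 0`. [cite: HuShuYin2019, p. 4] -/
theorem cubeSumCurve_one_a₂ : ((cubeSumCurve 1).baseChange K).a₂ = 0 := by
  simp [WeierstrassCurve.baseChange, cubeSumCurve]

/-- `E₁/K` has `a₃ = 0`. [cite: HuShuYin2019, p. 4] -/
theorem cubeSumCurve_one_a₃ : ((cubeSumCurve 1).baseChange K).a₃ = 0 := by
  simp [WeierstrassCurve.baseChange, cubeSumCurve]

/-- `E₁/K` has `a₄ = 0`. [cite: HuShuYin2019, p. 4] -/
theorem cubeSumCurve_one_a₄ : ((cubeSumCurve 1).baseChange K).a₄ = 0 := by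
  simp [WeierstrassCurve.baseChange, cubeSumCurve]

/-- `E₁/K` has `a₆ = −432`. [cite: HuShuYin2019, p. 4] -/
theorem cubeSumCurve_one_a₆ : ((cubeSumCurve 1).baseChange K).a₆ = -432 := by
  simp [WeierstrassCurve.baseChange, cubeSumCurve]

/-- **`E₁[3](K̄)` = the nine points**: an affine point `(x, y)` of `E₁/K` is `3`-torsion iff
`x = 0 ∨ x³ = 1728` (then `(x, y) ∈ {(0, ±12√−3), (12ζ, ±36)}` by `eq_of_three_nsmul_eq_zero`).
[cite: HuShuYin2019, pp. 7–8] -/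
theorem cubeSumCurve_one_three_nsmul_eq_zero_iff {x y : K}
    (hp : ((cubeSumCurve 1).baseChange K).toAffine.Nonsingular x y) :
    (3 : ℕ) • (.some x y hp : ((cubeSumCurve 1).baseChange K).toAffine.Point) = 0 ↔
      x = 0 ∨ x ^ 3 = 1728 :=
  three_nsmul_eq_zero_iff (by norm_num) (by norm_num) cubeSumCurve_one_a₁ cubeSumCurve_one_a₂
    cubeSumCurve_one_a₃ cubeSumCurve_one_a₄ cubeSumCurve_one_a₆ hp

/-- **(C-d)₃ for `E₁/K` verbatim**: for ANY `θ` acting by `[ω](x, y) = (ωx, y)` with `θ 𝒪 = 𝒪`, every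
`t ∈ E₁[√−3] = {𝒪, (0, ±12√−3)}` is `T − θT` for some `T ∈ E₁[3](K)` — «`T ↦ T − [ω]T` maps `E₁[3]` onto
`E₁[√−3]`, so there is `T′ ∈ E₁[3](K)` with `T′ − [ω]T′ = t′`» (memo §15.5 (C-d)). [cite: HuShuYin2019, p. 8] -/
theorem cubeSumCurve_one_exists_threeTorsion_sub_omegaRot_eq (hω : ω ^ 2 + ω + 1 = 0)
    {θ : ((cubeSumCurve 1).baseChange K).toAffine.Point → ((cubeSumCurve 1).baseChange K).toAffine.Point}
    (hθ0 : θ 0 = 0)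
    (hθ : ∀ (x y : K) (h : ((cubeSumCurve 1).baseChange K).toAffine.Nonsingular x y),
      θ (.some x y h) = .some (ω * x) y (nonsingular_omega_mul hω cubeSumCurve_one_a₁
        cubeSumCurve_one_a₂ cubeSumCurve_one_a₃ cubeSumCurve_one_a₄ h))
    (t : ((cubeSumCurve 1).baseChange K).toAffine.Point)
    (ht : t = 0 ∨ (∃ h, t = .some 0 (12 * (2 * ω + 1)) h) ∨ (∃ h, t = .some 0 (-(12 * (2 * ω + 1))) h)) :
    ∃ T : ((cubeSumCurve 1).baseChange K).toAffine.Point, (3 : ℕ) • T = 0 ∧ T - θ T = t := by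
  have h2K : (2 : K) ≠ 0 := by norm_num
  have h3K : (3 : K) ≠ 0 := by norm_num
  refine exists_threeTorsion_sub_omegaRot_eq hω h2K h3K cubeSumCurve_one_a₁ cubeSumCurve_one_a₂
    cubeSumCurve_one_a₃ cubeSumCurve_one_a₄ cubeSumCurve_one_a₆ hθ hθ0 t ?_
  rcases ht with h | ⟨_, h⟩ | ⟨_, h⟩
  · exact Or.inl h
  · exact Or.inr (Or.inl h)
  · exact Or.inr (Or.inr h)

end HSY

end Summit.BirchSwinnertonDyer.BirchSwinnertonDyer.Theorems.SylvesterTwoThmCTorsion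

end
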